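import Mathlib
import Summits.ValiantsHypothesis.ValiantsHypothesis.Theorems.LacunarySymmetroidMatrixDescartesDefiniteMomentsZonesExactWindow

/-!
# `MatrixDescartes` (stmt-ValiantsHypothesis-18050) — the DEFINITE-MOMENTS LAW, zones EXACT III: THE INDEX-AWARE MANY-WINDOWS
# ENGINE — on a chain of DIRECTED windows the roots of `det F` (weighted by kernel dimension) are paid for by the index jumps:
# `#{roots in [w₀, w_N)} ≤ ∑ⱼ max(Δ⁺ν_j, Δ⁺π_j) ≤ N·m`

HONEST FRAMING.  Cell `pub-symmetroid`, seat `val-sym-mdr-p2` (gen 16); helper file `--supports` the crux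
`Theses.LacunarySymmetroid.MatrixDescartes`, NO closure claim.  A sector law beside the crux generalising gen 4's `N`-window
engine (`ManyWindows`: Loewner-monotone windows ⇒ `Z₊ ≤ N·m`) and gen 14's Theorem A (definite ends): the hypothesis per window
is only ONE-WAY PROPAGATION of the sign of every Rayleigh quotient (implied by Loewner monotonicity of `F/w`, by «one zero and
definite ends», …), the direction may change from window to window, and the count is INDEX-AWARE.  Nothing here bears on the
crux in its window, on `stub_twoSided`, on `DoorA26`/`DoorA34`, registers, or `VP ≠ VNP`.

THEOREM (`card_roots_le_sum_indexJump`).  `F(X) = ∑ₖ X^{dₖ}Sₖ`, real symmetric letters; scales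
`w₀ < w₁ < ⋯ < w_N` such that on each closed window `[wⱼ, wⱼ₊₁]` EITHER non-positivity of every Rayleigh form propagates
upward (`vᵀF(s)v ≤ 0 ⇒ vᵀF(t)v < 0` for `s < t`) OR non-negativity does.  Then the number of DISTINCT roots of `det F` in
`[w₀, w_N)` — indeed the total kernel dimension there (`sum_corank_windows_le_sum_indexJump`) — is at most
`∑ⱼ max(ν(F(wⱼ₊₁)) ∸ ν(F(wⱼ)), π(F(wⱼ₊₁)) ∸ π(F(wⱼ)))`, which is at most `N · card ι` (`card_roots_le_mul_of_directedWindows`).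
PROOF: per window the directed Sylvester climb `DefiniteMoments.negIndex/posIndex_add_sum_corank_le_of_directed` (pure algebra);
windows `[wⱼ, wⱼ₊₁)` partition `[w₀, w_N)`. [folklore]; axioms standard; no definitions.
-/

-- layout Summits/ValiantsHypothesis/ValiantsHypothesis forces the duplicated namespace component
set_option linter.dupNamespace false

namespace Summit.ValiantsHypothesis.ValiantsHypothesis.Theorems.LacunarySymmetroidMatrixDescartes

open Polynomial Matrix Finset
open scoped BigOperators Topology

namespace DefiniteMoments

variable {ι : Type} [Fintype ι] [DecidableEq ι]

/-! ## §1 One directed window, either direction -/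

/-- **One directed window, either direction**: `corank F(a) + ∑_{t ∈ T ∩ (a,b)} corank F(t) ≤ max(ν(b) ∸ ν(a), π(b) ∸ π(a))`
for any hermitian family on which, over `[a, b]`, EITHER non-positivity OR non-negativity of every Rayleigh form propagates
upward. [folklore] -/
theorem corank_add_sum_le_indexJump (F : ℝ → Matrix ι ι ℝ) (hH : ∀ x, (F x).IsHermitian) (T : Finset ℝ) {a b : ℝ}
    (hab : a < b)
    (hdir : (∀ v : ι → ℝ, v ≠ 0 → ∀ s t : ℝ, a ≤ s → s < t → t ≤ b → v ⬝ᵥ (F s *ᵥ v) ≤ 0 → v ⬝ᵥ (F t *ᵥ v) < 0) ∨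
      (∀ v : ι → ℝ, v ≠ 0 → ∀ s t : ℝ, a ≤ s → s < t → t ≤ b → 0 ≤ v ⬝ᵥ (F s *ᵥ v) → 0 < v ⬝ᵥ (F t *ᵥ v))) :
    (Fintype.card ι - (F a).rank) + ∑ t ∈ T.filter (fun t => a < t ∧ t < b), (Fintype.card ι - (F t).rank)
      ≤ max (Fintype.card {j // (hH b).eigenvalues j < 0} - Fintype.card {j // (hH a).eigenvalues j < 0})
          (Fintype.card {j // 0 < (hH b).eigenvalues j} - Fintype.card {j // 0 < (hH a).eigenvalues j}) := by
  rcases hdir with hneg | hpos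
  · have h := negIndex_add_sum_corank_le_of_directed F hH T _ a b hab le_rfl hneg
    refine le_trans ?_ (le_max_left _ _)
    omega
  · have h := posIndex_add_sum_corank_le_of_directed F hH T hab hpos
    refine le_trans ?_ (le_max_right _ _)
    omega

/-- The index jump of one window is at most `card ι`. [folklore] -/
theorem indexJump_le_card {A B : Matrix ι ι ℝ} (hA : A.IsHermitian) (hB : B.IsHermitian) :
    max (Fintype.card {j // hB.eigenvalues j < 0} - Fintype.card {j // hA.eigenvalues j < 0})
        (Fintype.card {j // 0 < hB.eigenvalues j} - Fintype.card {j // 0 < hA.eigenvalues j}) ≤ Fintype.card ι := by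
  have h1 := Fintype.card_subtype_le fun j => hB.eigenvalues j < 0
  have h2 := Fintype.card_subtype_le fun j => 0 < hB.eigenvalues j
  refine max_le ?_ ?_ <;> omega

/-! ## §2 A chain of directed windows -/

/-- **THE INDEX-AWARE MANY-WINDOWS ENGINE (kernel-dimension form, any hermitian family).**  Scales `w₀ < ⋯ < w_N`, each
window `[wⱼ, wⱼ₊₁]` directed either way.  Then the coranks at the left ends plus the coranks at the `T`-points inside the
windows are paid for by the index jumps: `∑ⱼ (corank F(wⱼ) + ∑_{T ∩ (wⱼ,wⱼ₊₁)} corank) ≤ ∑ⱼ max(Δ⁺νⱼ, Δ⁺πⱼ)`. [folklore] -/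
theorem sum_corank_windows_le_sum_indexJump (F : ℝ → Matrix ι ι ℝ) (hH : ∀ x, (F x).IsHermitian) (T : Finset ℝ)
    {N : ℕ} (w : Fin (N + 1) → ℝ) (hw : StrictMono w)
    (hdir : ∀ j : Fin N,
      (∀ v : ι → ℝ, v ≠ 0 → ∀ s t : ℝ, w j.castSucc ≤ s → s < t → t ≤ w j.succ →
          v ⬝ᵥ (F s *ᵥ v) ≤ 0 → v ⬝ᵥ (F t *ᵥ v) < 0) ∨
      (∀ v : ι → ℝ, v ≠ 0 → ∀ s t : ℝ, w j.castSucc ≤ s → s < t → t ≤ w j.succ →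
          0 ≤ v ⬝ᵥ (F s *ᵥ v) → 0 < v ⬝ᵥ (F t *ᵥ v))) :
    ∑ j : Fin N, ((Fintype.card ι - (F (w j.castSucc)).rank)
        + ∑ t ∈ T.filter (fun t => w j.castSucc < t ∧ t < w j.succ), (Fintype.card ι - (F t).rank))
      ≤ ∑ j : Fin N, max
          (Fintype.card {i // (hH (w j.succ)).eigenvalues i < 0} - Fintype.card {i // (hH (w j.castSucc)).eigenvalues i < 0})
          (Fintype.card {i // 0 < (hH (w j.succ)).eigenvalues i} - Fintype.card {i // 0 < (hH (w j.castSucc)).eigenvalues i}) :=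
  Finset.sum_le_sum fun j _ => corank_add_sum_le_indexJump F hH T (hw (Fin.castSucc_lt_succ)) (hdir j)

/-- The total index jump over `N` windows is at most `N · card ι`. [folklore] -/
theorem sum_indexJump_le (F : ℝ → Matrix ι ι ℝ) (hH : ∀ x, (F x).IsHermitian) {N : ℕ} (w : Fin (N + 1) → ℝ) :
    ∑ j : Fin N, max
          (Fintype.card {i // (hH (w j.succ)).eigenvalues i < 0} - Fintype.card {i // (hH (w j.castSucc)).eigenvalues i < 0})
          (Fintype.card {i // 0 < (hH (w j.succ)).eigenvalues i} - Fintype.card {i // 0 < (hH (w j.castSucc)).eigenvalues i})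
      ≤ N * Fintype.card ι := by
  calc _ ≤ ∑ _j : Fin N, Fintype.card ι := Finset.sum_le_sum fun j _ => indexJump_le_card (hH _) (hH _)
    _ = N * Fintype.card ι := by rw [Finset.sum_const, Finset.card_univ, Fintype.card_fin, smul_eq_mul]

/-! ## §3 Lacunary symmetric pencils: distinct roots on a chain of directed windows -/

section Pencil

variable {κ : Type} [Fintype κ]

omit [DecidableEq ι] in
/-- A singular real symmetric matrix has positive corank. [folklore] -/
theorem one_le_corank_of_det_eq_zero [DecidableEq ι] {A : Matrix ι ι ℝ} (h : A.det = 0) :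
    1 ≤ Fintype.card ι - A.rank := by
  obtain ⟨v, hv, hAv⟩ := Matrix.exists_mulVec_eq_zero_iff.2 h
  have hr := Multiplicity.rank_add_le_of_kernel_family A ![v] (by
    rw [Fintype.linearIndependent_iff]
    intro g hg i
    fin_cases i
    have : g 0 • v = 0 := by simpa using hg
    rcases smul_eq_zero.1 this with h0 | h0
    · exact h0
    · exact absurd h0 hv) (fun i => by fin_cases i; exact hAv)
  omega

/-- **Half-open window**: the distinct roots of `det F` in `[a, b)` number at most `corank F(a)` plus the coranks at the
roots in `(a, b)`. [folklore] -/
theorem card_roots_Ico_le_corank_add_sum (d : κ → ℕ) (S : κ → Matrix ι ι ℝ) (a b : ℝ) :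
    ((Matrix.det (∑ k, ((X : ℝ[X]) ^ d k) • (S k).map C)).roots.toFinset.filter (fun t => a ≤ t ∧ t < b)).card
      ≤ (Fintype.card ι - (∑ k, a ^ d k • S k).rank)
        + ∑ t ∈ (Matrix.det (∑ k, ((X : ℝ[X]) ^ d k) • (S k).map C)).roots.toFinset.filter (fun t => a < t ∧ t < b),
            (Fintype.card ι - (∑ k, t ^ d k • S k).rank) := by
  classical
  set R := (Matrix.det (∑ k, ((X : ℝ[X]) ^ d k) • (S k).map C)).roots.toFinset with hR
  -- interior roots each contribute at least one
  have hinner : (R.filter (fun t => a < t ∧ t < b)).card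
      ≤ ∑ t ∈ R.filter (fun t => a < t ∧ t < b), (Fintype.card ι - (∑ k, t ^ d k • S k).rank) := by
    rw [Finset.card_eq_sum_ones]
    refine Finset.sum_le_sum fun t ht => one_le_corank_of_det_eq_zero ?_
    exact det_eval_eq_zero_of_mem d S (Finset.mem_filter.1 ht).1
  have hsub : R.filter (fun t => a ≤ t ∧ t < b) ⊆ insert a (R.filter (fun t => a < t ∧ t < b)) := by
    intro t ht
    obtain ⟨htR, h1, h2⟩ := Finset.mem_filter.1 ht
    rcases eq_or_lt_of_le h1 with rfl | h1'
    · exact Finset.mem_insert_self _ _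
    · exact Finset.mem_insert_of_mem (Finset.mem_filter.2 ⟨htR, h1', h2⟩)
  by_cases ha : (∑ k, a ^ d k • S k).det = 0
  · have h1 := one_le_corank_of_det_eq_zero ha
    have h2 := le_trans (Finset.card_le_card hsub) (Finset.card_insert_le _ _)
    omega
  · -- `a` is not a root: the half-open and open windows have the same roots
    have haR : a ∉ R := fun h => ha (det_eval_eq_zero_of_mem d S h)
    have heq : R.filter (fun t => a ≤ t ∧ t < b) = R.filter (fun t => a < t ∧ t < b) :=
      Finset.filter_congr fun t ht =>
        ⟨fun h => ⟨lt_of_le_of_ne h.1 (fun e => haR (e ▸ ht)), h.2⟩, fun h => ⟨h.1.le, h.2⟩⟩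
    rw [heq]
    exact le_trans hinner (Nat.le_add_left _ _)

omit [Fintype ι] [DecidableEq ι] in
/-- Half-open windows of a chain of scales are disjoint. [folklore] -/
theorem window_eq_of_mem_Ico {N : ℕ} (w : Fin (N + 1) → ℝ) (hw : StrictMono w) (j j' : Fin N) (x : ℝ)
    (h1 : w j.castSucc ≤ x) (h2 : x < w j.succ) (h3 : w j'.castSucc ≤ x) (h4 : x < w j'.succ) : j = j' := by
  by_contra hne
  rcases lt_or_gt_of_ne hne with h | h
  · have hle : w j.succ ≤ w j'.castSucc := hw.monotone (by
      rw [Fin.le_def, Fin.val_succ, Fin.val_castSucc]; exact Fin.lt_def.1 h)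
    linarith
  · have hle : w j'.succ ≤ w j.castSucc := hw.monotone (by
      rw [Fin.le_def, Fin.val_succ, Fin.val_castSucc]; exact Fin.lt_def.1 h)
    linarith

omit [Fintype ι] [DecidableEq ι] in
/-- Every point of `[w₀, w_N)` lies in one of the half-open windows. [folklore] -/
theorem exists_window_of_mem_Ico {N : ℕ} (w : Fin (N + 1) → ℝ) {t : ℝ} (h1 : w 0 ≤ t)
    (h2 : t < w (Fin.last N)) : ∃ j : Fin N, w j.castSucc ≤ t ∧ t < w j.succ := by
  classical
  set s := Finset.univ.filter (fun i : Fin (N + 1) => w i ≤ t) with hs_def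
  have hs : s.Nonempty := ⟨0, Finset.mem_filter.2 ⟨Finset.mem_univ _, h1⟩⟩
  set i₀ := s.max' hs with hi₀_def
  have hi₀ : w i₀ ≤ t := (Finset.mem_filter.1 (Finset.max'_mem s hs)).2
  have hne : i₀ ≠ Fin.last N := fun h => by
    rw [h] at hi₀
    exact absurd h2 (not_lt.2 hi₀)
  obtain ⟨j, hj⟩ : ∃ j : Fin N, j.castSucc = i₀ := ⟨i₀.castPred hne, Fin.castSucc_castPred _ _⟩
  refine ⟨j, by rw [hj]; exact hi₀, ?_⟩
  by_contra hle
  push Not at hle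
  have hmem : j.succ ∈ s := Finset.mem_filter.2 ⟨Finset.mem_univ _, hle⟩
  have hmax := s.le_max' _ hmem
  rw [← hi₀_def, ← hj] at hmax
  exact absurd hmax (not_le.2 (Fin.castSucc_lt_succ))

omit [Fintype ι] [DecidableEq ι] in
/-- The half-open windows partition `[w₀, w_N)`. [folklore] -/
theorem card_filter_Ico_eq_sum (R : Finset ℝ) {N : ℕ} (w : Fin (N + 1) → ℝ) (hw : StrictMono w) :
    (R.filter (fun t => w 0 ≤ t ∧ t < w (Fin.last N))).card
      = ∑ j : Fin N, (R.filter (fun t => w j.castSucc ≤ t ∧ t < w j.succ)).card := by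
  classical
  have hdisj : ((Finset.univ : Finset (Fin N)) : Set (Fin N)).PairwiseDisjoint
      (fun j : Fin N => R.filter (fun t => w j.castSucc ≤ t ∧ t < w j.succ)) := by
    intro j _ j' _ hne
    rw [Function.onFun, Finset.disjoint_left]
    intro t ht ht'
    obtain ⟨-, h1, h2⟩ := Finset.mem_filter.1 ht
    obtain ⟨-, h3, h4⟩ := Finset.mem_filter.1 ht'
    exact hne (window_eq_of_mem_Ico w hw j j' t h1 h2 h3 h4)
  rw [← Finset.card_biUnion hdisj]
  congr 1
  ext t
  rw [Finset.mem_filter, Finset.mem_biUnion]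
  constructor
  · rintro ⟨htR, h1, h2⟩
    obtain ⟨j, hj1, hj2⟩ := exists_window_of_mem_Ico w h1 h2
    exact ⟨j, Finset.mem_univ _, Finset.mem_filter.2 ⟨htR, hj1, hj2⟩⟩
  · rintro ⟨j, -, hj⟩
    obtain ⟨htR, h1, h2⟩ := Finset.mem_filter.1 hj
    exact ⟨htR, le_trans (hw.monotone (Fin.zero_le _)) h1, lt_of_lt_of_le h2 (hw.monotone (Fin.le_last _))⟩

/-- **THE INDEX-AWARE MANY-WINDOWS ENGINE (lacunary symmetric pencils).**  `F(X) = ∑ₖ X^{dₖ}Sₖ` real symmetric;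
scales `w₀ < ⋯ < w_N` with each closed window `[wⱼ, wⱼ₊₁]` DIRECTED (non-positivity of every Rayleigh form propagates upward,
or non-negativity does).  Then the distinct roots of `det F` in `[w₀, w_N)` number at most `∑ⱼ max(Δ⁺νⱼ, Δ⁺πⱼ)`. [folklore] -/
theorem card_roots_le_sum_indexJump (d : κ → ℕ) (S : κ → Matrix ι ι ℝ) (hS : ∀ k, (S k).IsSymm)
    {N : ℕ} (w : Fin (N + 1) → ℝ) (hw : StrictMono w)
    (hdir : ∀ j : Fin N,
      (∀ v : ι → ℝ, v ≠ 0 → ∀ s t : ℝ, w j.castSucc ≤ s → s < t → t ≤ w j.succ →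
          v ⬝ᵥ ((∑ k, s ^ d k • S k) *ᵥ v) ≤ 0 → v ⬝ᵥ ((∑ k, t ^ d k • S k) *ᵥ v) < 0) ∨
      (∀ v : ι → ℝ, v ≠ 0 → ∀ s t : ℝ, w j.castSucc ≤ s → s < t → t ≤ w j.succ →
          0 ≤ v ⬝ᵥ ((∑ k, s ^ d k • S k) *ᵥ v) → 0 < v ⬝ᵥ ((∑ k, t ^ d k • S k) *ᵥ v))) :
    ((Matrix.det (∑ k, ((X : ℝ[X]) ^ d k) • (S k).map C)).roots.toFinset.filter
        (fun t => w 0 ≤ t ∧ t < w (Fin.last N))).card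
      ≤ ∑ j : Fin N, max
          (Fintype.card {i // (Inertia.isHermitian_pencil d S hS (w j.succ)).eigenvalues i < 0}
            - Fintype.card {i // (Inertia.isHermitian_pencil d S hS (w j.castSucc)).eigenvalues i < 0})
          (Fintype.card {i // 0 < (Inertia.isHermitian_pencil d S hS (w j.succ)).eigenvalues i}
            - Fintype.card {i // 0 < (Inertia.isHermitian_pencil d S hS (w j.castSucc)).eigenvalues i}) := by
  classical
  set R := (Matrix.det (∑ k, ((X : ℝ[X]) ^ d k) • (S k).map C)).roots.toFinset with hR
  rw [card_filter_Ico_eq_sum R w hw]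
  have h := sum_corank_windows_le_sum_indexJump (fun x => ∑ k, x ^ d k • S k) (Inertia.isHermitian_pencil d S hS) R w hw
    hdir
  refine le_trans (Finset.sum_le_sum fun j _ => card_roots_Ico_le_corank_add_sum d S _ _) ?_
  exact h

/-- **Corollary: `N` directed windows carry at most `N · card ι` distinct roots.** [folklore] -/
theorem card_roots_le_mul_of_directedWindows (d : κ → ℕ) (S : κ → Matrix ι ι ℝ) (hS : ∀ k, (S k).IsSymm)
    {N : ℕ} (w : Fin (N + 1) → ℝ) (hw : StrictMono w)
    (hdir : ∀ j : Fin N,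
      (∀ v : ι → ℝ, v ≠ 0 → ∀ s t : ℝ, w j.castSucc ≤ s → s < t → t ≤ w j.succ →
          v ⬝ᵥ ((∑ k, s ^ d k • S k) *ᵥ v) ≤ 0 → v ⬝ᵥ ((∑ k, t ^ d k • S k) *ᵥ v) < 0) ∨
      (∀ v : ι → ℝ, v ≠ 0 → ∀ s t : ℝ, w j.castSucc ≤ s → s < t → t ≤ w j.succ →
          0 ≤ v ⬝ᵥ ((∑ k, s ^ d k • S k) *ᵥ v) → 0 < v ⬝ᵥ ((∑ k, t ^ d k • S k) *ᵥ v))) :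
    ((Matrix.det (∑ k, ((X : ℝ[X]) ^ d k) • (S k).map C)).roots.toFinset.filter
        (fun t => w 0 ≤ t ∧ t < w (Fin.last N))).card ≤ N * Fintype.card ι :=
  le_trans (card_roots_le_sum_indexJump d S hS w hw hdir)
    (sum_indexJump_le (fun x => ∑ k, x ^ d k • S k) (Inertia.isHermitian_pencil d S hS) w)

end Pencil

end DefiniteMoments

end Summit.ValiantsHypothesis.ValiantsHypothesis.Theorems.LacunarySymmetroidMatrixDescartes
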